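import Summits.Ventures.DiscreteObjects.Hadamard.NonCyclicLP333
import Literature.Combinatorics.Designs.LegendrePairs.Mod3Obstruction333

/-!
# Hadamard 668 census, family F5c — lattice lemmas for the non-cyclic group `G333 = (Z₃ × Z₃) × Z₃₇`

Framing: lottery ticket; floor = certified bounds/negative ranges.

Cell pub-namedobj (venture DiscreteObjects), target (H), gen 3; companion of `NonCyclicLP333.lean` (definitions, HIT route,
kernel controls, the `j ↦ 4j` obstruction).  The symmetry lattice of family F5c (Legendre pairs over `G333` with both arrays
invariant under a common `K ≤ Aut(G333) = GL(2,3) × Z₃₇ˣ`, FAMILY-F5C.md §2) rests on two cheap exact obstructions, proved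
here in the kernel (ours):
* `no_legendrePairOn_G333_of_quotient_inverted` — if a bijection `σ` of `G333` fixes both arrays and inverts a quotient
  `φ : G333 → Z₃` with fibres of size `111` (`φ ∘ σ = -φ`), there is no Legendre pair: compressing along `φ` gives
  `Σ cᵢ² + Σ dᵢ² = 446`, `Σ cᵢcᵢ₊₁ + Σ dᵢdᵢ₊₁ = -222` ([DjokovicKotsireas2015, Thm 3]-type identities along an arbitrary hom to
  `Z₃`), `σ` ties `c₁ = c₂`, `d₁ = d₂`, whence `(c₀-c₁)² + (d₀-d₁)² = 668 = 4·167`, impossible (tree `not_sq_add_sq_668`).  This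
  is the non-cyclic form of [RamosHulakDeQueiroz2026, Prop. 1] (`H ≤ U₁`, tree `rhdq_prop1`); with the eigenvalue criterion
  for `GL(2,3)` (an element has eigenvalue `-1` iff it inverts some quotient line) it confines the census to `K ≤ T × Z₃₇ˣ`,
  `T` a Sylow 3-subgroup.  Instance: `no_symmetric_legendrePairOn_G333` (`σ = -id`, `φ = ` first coordinate).
* `no_legendrePairOn_G333_of_tau` — no pair with both arrays invariant under the transvection `τ : (x, y, j) ↦ (x + y, y, j)`:
  such an array is `x`-periodic off the plane `y = 0`, so `PAF(e₁) ≥ 222 - 111 = 111` for each array against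
  `PAF_a(e₁) + PAF_b(e₁) = -2` (the nine census classes containing `τ`; cyclic analogue: the multiplier-112 / shift-111
  obstruction closing arXiv:2607.20765 IDs 2 and 7, tree `MultiplierObstruction.lean`).
* `no_legendrePairOn_G333_inv8` — no pair with an array invariant under `(v, j) ↦ (v, 8j)` (census classes K12, K21): the row
  sum of such a `±1` array is `s + 12u` with `|s| ≤ 9` and `u` odd, never `±1` (`rowsum_ne_of_inv8`; cyclic analogue: the
  "row-sum mod 24" rows 16, 17, 18, 24 of arXiv:2607.20765 Table A1).
Kernel coverage of the 24-class lattice of FAMILY-F5C.md: every class outside `T × Z₃₇ˣ` (this lemma, given the `GL(2,3)`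
criterion), the nine `τ`-classes, K12/K21 (`inv8`), K15/K19 (`inv4`, companion file) — 13 of the 20 decided classes (14 with
`NonCyclicLP333RowSums.lean`, class K14); K05, K06, K08, K09, K11, K17 rest on the two-implementation compression sieve (cell files;
K09 also has a hand proof there, K17 ⊂ K06).
No `sorry`, no `native_decide`.
-/

namespace Summit.Ventures.DiscreteObjects.Hadamard

open Finset BigOperators
open Literature.Combinatorics.Designs.LegendrePairs (PAFOn IsPMOn LegendrePairOn pafOn_zero rowsum_sq_on)

/-! ### the quotient-3 obstruction (lattice Lemma 1 of FAMILY-F5C.md): a common symmetry must not invert an index-3 quotient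

For a homomorphism `φ : G333 → Z₃` with fibres of size `111` (i.e. `φ` surjective) put `c_i = Σ_{φ h = i} a(h)`.  Summing the
Legendre identities over the fibres gives `Σ c_i² + Σ d_i² = 446` and `Σ c_i c_{i+1} + Σ d_i d_{i+1} = -222`
([DjokovicKotsireas2015, Thm 3]-type compression identities, here along an arbitrary hom to `Z₃`).  If a bijection `σ` of
`G333` fixes both arrays and inverts the quotient (`φ ∘ σ = -φ`) then `c₁ = c₂`, `d₁ = d₂`, and the two identities combine to
`(c₀ - c₁)² + (d₀ - d₁)² = 668 = 4·167`, impossible (tree: `not_sq_add_sq_668`).  This is the non-cyclic form of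
[RamosHulakDeQueiroz2026, Prop. 1] (`H ≤ U₁`); with the eigenvalue criterion for `GL(2,3)` it confines the census to
`K ≤ T × Z₃₇ˣ` (FAMILY-F5C.md §2). -/

/-- fibre indicator of `φ` at `i`. -/
def indQ (φ : G333 →+ ZMod 3) (i : ZMod 3) (h : G333) : ℤ := if φ h = i then 1 else 0

/-- compression along `φ`: `c_i = Σ_{φ h = i} a(h)`. -/
def compQ (φ : G333 →+ ZMod 3) (c : G333 → ℤ) (i : ZMod 3) : ℤ := ∑ h, indQ φ i h * c h

/-- orthogonality of the three fibre indicators (diagonal form). -/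
private lemma indQ_diag (x y : ZMod 3) :
    ((if x = 0 then (1:ℤ) else 0) * (if y = 0 then 1 else 0) + (if x = 1 then (1:ℤ) else 0) * (if y = 1 then 1 else 0)
      + (if x = 2 then (1:ℤ) else 0) * (if y = 2 then 1 else 0)) = if y = x + 0 then 1 else 0 := by
  revert x y; decide

/-- orthogonality of the three fibre indicators (cross form). -/
private lemma indQ_cross (x y : ZMod 3) :
    ((if x = 0 then (1:ℤ) else 0) * (if y = 1 then 1 else 0) + (if x = 1 then (1:ℤ) else 0) * (if y = 2 then 1 else 0)
      + (if x = 2 then (1:ℤ) else 0) * (if y = 0 then 1 else 0)) = if y = x + 1 then 1 else 0 := by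
  revert x y; decide

/-- a product of two compression entries as a double sum. -/
private lemma compQ_mul (φ : G333 →+ ZMod 3) (c : G333 → ℤ) (i j : ZMod 3) :
    compQ φ c i * compQ φ c j = ∑ h, ∑ h', (indQ φ i h * indQ φ j h') * (c h * c h') := by
  unfold compQ
  rw [Finset.sum_mul_sum]
  refine Finset.sum_congr rfl fun h _ => Finset.sum_congr rfl fun h' _ => ?_
  ring

/-- the double sum `Σ_h Σ_h' [φ h' = φ h + r] c(h) c(h')` is the fibre sum `Σ_{φ s = r} PAF_c(s)`. -/
private lemma dsum_eq_fibre_paf (φ : G333 →+ ZMod 3) (c : G333 → ℤ) (r : ZMod 3) :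
    (∑ h, ∑ h', (if φ h' = φ h + r then (1:ℤ) else 0) * (c h * c h')) = ∑ s, indQ φ r s * PAFOn c s := by
  unfold PAFOn indQ
  simp_rw [Finset.mul_sum]
  conv_rhs => rw [Finset.sum_comm]
  refine Finset.sum_congr rfl fun h _ => ?_
  rw [← Equiv.sum_comp (Equiv.subRight h) (fun s => (if φ s = r then (1:ℤ) else 0) * (c h * c (h + s)))]
  refine Finset.sum_congr rfl fun h' _ => ?_
  simp only [Equiv.subRight_apply, map_sub, add_sub_cancel]
  have e : (φ h' - φ h = r) ↔ (φ h' = φ h + r) := by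
    constructor <;> intro q
    · rw [← q]; abel
    · rw [q]; abel
  by_cases q : φ h' = φ h + r
  · rw [if_pos (e.mpr q), if_pos q]
  · rw [if_neg (fun q' => q (e.mp q')), if_neg q]

/-- diagonal compression identity along `φ`: `c₀² + c₁² + c₂² = Σ_{φ s = 0} PAF_c(s)`. -/
lemma compQ_diag (φ : G333 →+ ZMod 3) (c : G333 → ℤ) :
    compQ φ c 0 * compQ φ c 0 + compQ φ c 1 * compQ φ c 1 + compQ φ c 2 * compQ φ c 2
      = ∑ s, indQ φ 0 s * PAFOn c s := by
  rw [compQ_mul, compQ_mul, compQ_mul, ← Finset.sum_add_distrib, ← Finset.sum_add_distrib, ← dsum_eq_fibre_paf]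
  refine Finset.sum_congr rfl fun h _ => ?_
  rw [← Finset.sum_add_distrib, ← Finset.sum_add_distrib]
  refine Finset.sum_congr rfl fun h' _ => ?_
  rw [← add_mul, ← add_mul]
  unfold indQ
  rw [indQ_diag (φ h) (φ h')]

/-- cross compression identity along `φ`: `c₀c₁ + c₁c₂ + c₂c₀ = Σ_{φ s = 1} PAF_c(s)`. -/
lemma compQ_cross (φ : G333 →+ ZMod 3) (c : G333 → ℤ) :
    compQ φ c 0 * compQ φ c 1 + compQ φ c 1 * compQ φ c 2 + compQ φ c 2 * compQ φ c 0
      = ∑ s, indQ φ 1 s * PAFOn c s := by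
  rw [compQ_mul, compQ_mul, compQ_mul, ← Finset.sum_add_distrib, ← Finset.sum_add_distrib, ← dsum_eq_fibre_paf]
  refine Finset.sum_congr rfl fun h _ => ?_
  rw [← Finset.sum_add_distrib, ← Finset.sum_add_distrib]
  refine Finset.sum_congr rfl fun h' _ => ?_
  rw [← add_mul, ← add_mul]
  unfold indQ
  rw [indQ_cross (φ h) (φ h')]

/-- fibre sums of `PAF_a + PAF_b` for a Legendre pair: `668·[φ 0 = r] - 2·#{φ = r}`. -/
lemma fibre_paf_pair (φ : G333 →+ ZMod 3) (a b : G333 → ℤ) (h : LegendrePairOn a b) (r : ZMod 3) :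
    (∑ s, indQ φ r s * PAFOn a s) + (∑ s, indQ φ r s * PAFOn b s)
      = 668 * indQ φ r 0 - 2 * ∑ s, indQ φ r s := by
  have key : ∀ s : G333, PAFOn a s + PAFOn b s = 668 * (if s = 0 then 1 else 0) - 2 := by
    intro s
    by_cases hs : s = 0
    · subst hs; rw [pafOn_zero a h.1, pafOn_zero b h.2.1, card_G333]; norm_num
    · rw [h.2.2 s hs, if_neg hs]; ring
  rw [← Finset.sum_add_distrib]
  have : ∀ s : G333, indQ φ r s * PAFOn a s + indQ φ r s * PAFOn b s
      = 668 * (if s = 0 then indQ φ r s else 0) + (-2) * indQ φ r s := by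
    intro s; rw [← mul_add, key s]; split_ifs <;> ring
  rw [Finset.sum_congr rfl (fun s _ => this s), Finset.sum_add_distrib, ← Finset.mul_sum, ← Finset.mul_sum,
    Finset.sum_ite_eq' Finset.univ (0 : G333)]
  simp only [Finset.mem_univ, if_true]
  ring

/-- a symmetry inverting the quotient ties the two non-zero compression entries: `c₂ = c₁`. -/
lemma compQ_two_eq_one (φ : G333 →+ ZMod 3) (c : G333 → ℤ) (σ : G333 ≃ G333) (hφ : ∀ h, φ (σ h) = -φ h)
    (hc : ∀ h, c (σ h) = c h) : compQ φ c 2 = compQ φ c 1 := by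
  unfold compQ indQ
  rw [← Equiv.sum_comp σ (fun h => (if φ h = 2 then (1:ℤ) else 0) * c h)]
  refine Finset.sum_congr rfl fun h _ => ?_
  simp only [hφ h, hc h]
  have e : (-φ h = 2) ↔ (φ h = 1) := by
    constructor <;> intro q
    · have : φ h = -2 := by rw [← q, neg_neg]
      rw [this]; decide
    · rw [q]; decide
  by_cases q : φ h = 1
  · rw [if_pos (e.mpr q), if_pos q]
  · rw [if_neg (fun q' => q (e.mp q')), if_neg q]

/-- **Lattice Lemma 1 (quotient-3 obstruction) for the non-cyclic group of order 333.**  Let `φ : G333 → Z₃` be a homomorphism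
with `#φ⁻¹(0) = #φ⁻¹(1) = 111`, and `σ` a bijection of `G333` with `φ ∘ σ = -φ`.  Then no Legendre pair over `G333` has both
arrays `σ`-invariant.  (Ours; cyclic analogue: RHdQ Prop. 1, tree `rhdq_prop1`.) -/
theorem no_legendrePairOn_G333_of_quotient_inverted (φ : G333 →+ ZMod 3)
    (h0 : ∑ s, indQ φ 0 s = 111) (h1 : ∑ s, indQ φ 1 s = 111)
    (σ : G333 ≃ G333) (hφ : ∀ h, φ (σ h) = -φ h)
    (a b : G333 → ℤ) (ha : ∀ h, a (σ h) = a h) (hb : ∀ h, b (σ h) = b h) : ¬ LegendrePairOn a b := by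
  intro hL
  have D := fibre_paf_pair φ a b hL 0
  have X := fibre_paf_pair φ a b hL 1
  rw [← compQ_diag, ← compQ_diag, h0] at D
  rw [← compQ_cross, ← compQ_cross, h1] at X
  have i00 : indQ φ 0 0 = 1 := by unfold indQ; rw [map_zero, if_pos rfl]
  have i10 : indQ φ 1 0 = 0 := by unfold indQ; rw [map_zero]; decide
  rw [i00] at D
  rw [i10] at X
  have ca := compQ_two_eq_one φ a σ hφ ha
  have cb := compQ_two_eq_one φ b σ hφ hb
  rw [ca] at D X
  rw [cb] at D X
  apply Literature.Combinatorics.Designs.LegendrePairs.NineComp333.not_sq_add_sq_668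
    (compQ φ a 0 - compQ φ a 1) (compQ φ b 0 - compQ φ b 1)
  nlinarith [D, X]

set_option maxRecDepth 65536 in
/-- Example (class representatives outside `T × Z₃₇ˣ`): the central symmetry `h ↦ -h` of `G333` inverts the quotient
`(x, y, j) ↦ x`; so no Legendre pair over `G333` has both arrays symmetric (`a(-h) = a(h)`, `b(-h) = b(h)`).  -/
theorem no_symmetric_legendrePairOn_G333 (a b : G333 → ℤ) (ha : ∀ h, a (-h) = a h) (hb : ∀ h, b (-h) = b h) :
    ¬ LegendrePairOn a b := by
  let φ : G333 →+ ZMod 3 := (AddMonoidHom.fst (ZMod 3) (ZMod 3)).comp (AddMonoidHom.fst (ZMod 3 × ZMod 3) (ZMod 37))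
  have h0 : ∑ s, indQ φ 0 s = 111 := by unfold indQ; decide
  have h1 : ∑ s, indQ φ 1 s = 111 := by unfold indQ; decide
  refine no_legendrePairOn_G333_of_quotient_inverted φ h0 h1 (Equiv.neg G333) (fun h => ?_) a b
    (fun h => by simpa using ha h) (fun h => by simpa using hb h)
  simp [φ]


/-! ### the shift obstruction (the 9 classes containing `τ : (x, y, j) ↦ (x + y, y, j)`; analogue of the cyclic shift-111 bound) -/

/-- product of two `±1` values is `≥ -1`, and `= 1` when they are equal. -/
private lemma pm_mul_ge (x y : ℤ) (hx : x = 1 ∨ x = -1) (hy : y = 1 ∨ y = -1) : -1 ≤ x * y := by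
  rcases hx with h | h <;> rcases hy with h' | h' <;> subst h <;> subst h' <;> norm_num

set_option maxRecDepth 65536 in
/-- under `τ`-invariance the array is periodic under `x ↦ x + 1` off the plane `y = 0`, so `PAF_a(e₁) ≥ 222 - 111`. -/
lemma paf_e1_ge_of_tau (a : G333 → ℤ) (hpm : IsPMOn a) (ha : ∀ x y j, a ((x + y, y), j) = a ((x, y), j)) :
    111 ≤ PAFOn a (((1 : ZMod 3), 0), 0) := by
  unfold PAFOn
  -- termwise lower bound `g`
  let g : G333 → ℤ := fun h => if h.1.2 = 0 then -1 else 1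
  have hg : ∑ h : G333, g h = 111 := by decide
  rw [← hg]
  refine Finset.sum_le_sum fun h _ => ?_
  obtain ⟨⟨x, y⟩, j⟩ := h
  show g ((x, y), j) ≤ a ((x, y), j) * a (((x, y), j) + ((1, 0), 0))
  simp only [g, Prod.mk_add_mk, add_zero]
  split_ifs with hy
  · exact pm_mul_ge _ _ (hpm _) (hpm _)
  · -- `y ≠ 0`: `a ((x+1, y), j) = a ((x, y), j)` from `τ`-invariance (`y = 1`: once; `y = 2`: twice)
    have hper : a ((x + 1, y), j) = a ((x, y), j) := by
      have key : ∀ z : ZMod 3, ¬ z = 0 → z = 1 ∨ z = 2 := by decide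
      have hy' : y = 1 ∨ y = 2 := key y hy
      rcases hy' with rfl | rfl
      · exact ha x 1 j
      · have h1 := ha (x + 2) 2 j      -- a ((x+2+2, 2), j) = a ((x+2, 2), j)
        have h2 := ha x 2 j            -- a ((x+2, 2), j) = a ((x, 2), j)
        have e : x + 2 + 2 = x + 1 := by
          have h22 : (2 : ZMod 3) + 2 = 1 := by decide
          rw [add_assoc, h22]
        rw [e] at h1
        rw [h1, h2]
    rw [hper]
    rcases hpm ((x, y), j) with h | h <;> rw [h] <;> norm_num

set_option maxRecDepth 65536 in
/-- **Family F5c, the classes containing `τ` (K03, K07, K10, K13, K16, K18, K20, K22, K23): NONE.**  No Legendre pair over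
`G333` has both arrays invariant under `(x, y, j) ↦ (x + y, y, j)`: both autocorrelations at `e₁ = (1, 0, 0)` are `≥ 111`,
against `PAF_a(e₁) + PAF_b(e₁) = -2`.  (Ours; cyclic analogue: the multiplier-112 / shift-111 obstruction, tree
`MultiplierObstruction.lean`, closing arXiv:2607.20765 IDs 2, 7.) -/
theorem no_legendrePairOn_G333_of_tau (a b : G333 → ℤ) (ha : ∀ x y j, a ((x + y, y), j) = a ((x, y), j))
    (hb : ∀ x y j, b ((x + y, y), j) = b ((x, y), j)) : ¬ LegendrePairOn a b := by
  intro hL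
  have hA := paf_e1_ge_of_tau a hL.1 ha
  have hB := paf_e1_ge_of_tau b hL.2.1 hb
  have hne : ((((1 : ZMod 3), (0 : ZMod 3)), (0 : ZMod 37)) : G333) ≠ 0 := by decide
  have := hL.2.2 _ hne
  linarith


/-! ### the row-sum obstruction for the classes containing `j ↦ 8j` (K12, K21; cyclic analogue: RHdQ "row-sum mod 24" rows) -/

/-- `ZMod 37 = {0} ∪ 8^ℕ ∪ 2·8^ℕ ∪ 4·8^ℕ` (`8 = 2³` generates the subgroup of index `3` of `Z₃₇ˣ`). -/
lemma sum_Z37_split8 (f : ZMod 37 → ℤ) :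
    ∑ j, f j = f 0 + ∑ k : Fin 12, f (8 ^ (k : ℕ)) + ∑ k : Fin 12, f (2 * 8 ^ (k : ℕ)) + ∑ k : Fin 12, f (4 * 8 ^ (k : ℕ)) := by
  have hU : (Finset.univ : Finset (ZMod 37)) =
      {0} ∪ (Finset.univ.image fun k : Fin 12 => (8 : ZMod 37) ^ (k : ℕ)) ∪
        (Finset.univ.image fun k : Fin 12 => 2 * (8 : ZMod 37) ^ (k : ℕ)) ∪
        (Finset.univ.image fun k : Fin 12 => 4 * (8 : ZMod 37) ^ (k : ℕ)) := by decide
  have hd1 : Disjoint ({0} : Finset (ZMod 37)) (Finset.univ.image fun k : Fin 12 => (8 : ZMod 37) ^ (k : ℕ)) := by decide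
  have hd2 : Disjoint (({0} : Finset (ZMod 37)) ∪ (Finset.univ.image fun k : Fin 12 => (8 : ZMod 37) ^ (k : ℕ)))
      (Finset.univ.image fun k : Fin 12 => 2 * (8 : ZMod 37) ^ (k : ℕ)) := by decide
  have hd3 : Disjoint (({0} : Finset (ZMod 37)) ∪ (Finset.univ.image fun k : Fin 12 => (8 : ZMod 37) ^ (k : ℕ))
      ∪ (Finset.univ.image fun k : Fin 12 => 2 * (8 : ZMod 37) ^ (k : ℕ)))
      (Finset.univ.image fun k : Fin 12 => 4 * (8 : ZMod 37) ^ (k : ℕ)) := by decide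
  have hi1 : Function.Injective fun k : Fin 12 => (8 : ZMod 37) ^ (k : ℕ) := by decide
  have hi2 : Function.Injective fun k : Fin 12 => 2 * (8 : ZMod 37) ^ (k : ℕ) := by decide
  have hi4 : Function.Injective fun k : Fin 12 => 4 * (8 : ZMod 37) ^ (k : ℕ) := by decide
  rw [hU, Finset.sum_union hd3, Finset.sum_union hd2, Finset.sum_union hd1, Finset.sum_singleton,
    Finset.sum_image (fun x _ y _ h => hi1 h), Finset.sum_image (fun x _ y _ h => hi2 h),
    Finset.sum_image (fun x _ y _ h => hi4 h)]

/-- invariance under `j ↦ 8j` makes the array constant on `8^ℕ · j₀`. -/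
lemma inv8_pow (c : G333 → ℤ) (hc : ∀ v j, c (v, 8 * j) = c (v, j)) (v : ZMod 3 × ZMod 3) (j₀ : ZMod 37) :
    ∀ k : ℕ, c (v, 8 ^ k * j₀) = c (v, j₀) := by
  intro k
  induction k with
  | zero => simp
  | succ k ih => rw [pow_succ, mul_comm (8 ^ k : ZMod 37) 8, mul_assoc, hc, ih]

/-- the compression of a `(j ↦ 8j)`-invariant array: `e(v) = c(v,0) + 12 (c(v,1) + c(v,2) + c(v,4))`. -/
lemma comp37_inv8 (c : G333 → ℤ) (hc : ∀ v j, c (v, 8 * j) = c (v, j)) (v : ZMod 3 × ZMod 3) :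
    comp37 c v = c (v, 0) + 12 * (c (v, 1) + c (v, 2) + c (v, 4)) := by
  unfold comp37
  rw [sum_Z37_split8]
  have h1 : ∀ k : Fin 12, c (v, 8 ^ (k : ℕ)) = c (v, 1) := fun k => by
    have := inv8_pow c hc v 1 k; rwa [mul_one] at this
  have h2 : ∀ k : Fin 12, c (v, 2 * 8 ^ (k : ℕ)) = c (v, 2) := fun k => by
    have := inv8_pow c hc v 2 k; rwa [mul_comm] at this
  have h4 : ∀ k : Fin 12, c (v, 4 * 8 ^ (k : ℕ)) = c (v, 4) := fun k => by
    have := inv8_pow c hc v 4 k; rwa [mul_comm] at this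
  simp only [h1, h2, h4, Finset.sum_const, Finset.card_univ, Fintype.card_fin]
  ring

/-- **Family F5c, the classes containing `j ↦ 8j` (K12, K21): NONE, by the row sum alone.**  A `±1` array on `G333` invariant
under `(v, j) ↦ (v, 8j)` has `Σ a = s + 12u` with `|s| ≤ 9` (`s` = the nine values on the plane `j = 0`) and `u` a sum of
`27` signs, hence odd; so `Σ a ≠ 1`, whereas the arrays of a Legendre pair have row sums `±1` (and both signs are excluded:
`Σ a = -1` likewise).  Stated for pairs with row sum normalised to `+1` and for the symmetric `-1` case via negation. -/
theorem rowsum_ne_of_inv8 (c : G333 → ℤ) (hpm : IsPMOn c) (hc : ∀ v j, c (v, 8 * j) = c (v, j)) :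
    (∑ h, c h) ≠ 1 ∧ (∑ h, c h) ≠ -1 := by
  -- Σ_h c h = Σ_v comp37 c v
  have hsplit : ∑ h, c h = ∑ v, comp37 c v := by
    unfold comp37; rw [Fintype.sum_prod_type]
  rw [hsplit, Finset.sum_congr rfl (fun v _ => comp37_inv8 c hc v), Finset.sum_add_distrib, ← Finset.mul_sum]
  -- parity: each sign is `2 m + 1`
  let m : G333 → ℤ := fun h => if c h = 1 then 0 else -1
  have hm : ∀ h, c h = 2 * m h + 1 := fun h => by
    rcases hpm h with e | e <;> simp [m, e]
  have hb : ∀ h, -1 ≤ c h ∧ c h ≤ 1 := fun h => by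
    rcases hpm h with e | e <;> rw [e] <;> norm_num
  -- bound on the plane `j = 0`
  have hs : -9 ≤ ∑ v : ZMod 3 × ZMod 3, c (v, 0) ∧ ∑ v : ZMod 3 × ZMod 3, c (v, 0) ≤ 9 := by
    constructor
    · have := Finset.sum_le_sum (s := Finset.univ) fun (v : ZMod 3 × ZMod 3) _ => (hb (v, 0)).1
      simpa [ZMod.card] using this
    · have := Finset.sum_le_sum (s := Finset.univ) fun (v : ZMod 3 × ZMod 3) _ => (hb (v, 0)).2
      simpa [ZMod.card] using this
  -- the 27-term sum is `2 M + 27`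
  have hu : ∑ v : ZMod 3 × ZMod 3, (c (v, 1) + c (v, 2) + c (v, 4))
      = 2 * ∑ v : ZMod 3 × ZMod 3, (m (v, 1) + m (v, 2) + m (v, 4)) + 27 := by
    rw [Finset.sum_congr rfl (fun v _ => show c (v, 1) + c (v, 2) + c (v, 4) = 2 * (m (v, 1) + m (v, 2) + m (v, 4)) + 3 by
      rw [hm (v, 1), hm (v, 2), hm (v, 4)]; ring)]
    rw [Finset.sum_add_distrib, ← Finset.mul_sum, Finset.sum_const, Finset.card_univ]
    simp [ZMod.card]
  rw [hu]
  constructor <;> intro h <;> omega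

/-- no Legendre pair over `G333` with both (indeed: with either) arrays invariant under `(v, j) ↦ (v, 8j)`. -/
theorem no_legendrePairOn_G333_inv8 (a b : G333 → ℤ) (ha : ∀ v j, a (v, 8 * j) = a (v, j)) :
    ¬ LegendrePairOn a b := by
  intro hL
  rcases Literature.Combinatorics.Designs.LegendrePairs.pm_of_sq _ _ (rowsum_sq_on a b hL) with h1 | h1
  · exact (rowsum_ne_of_inv8 a hL.1 ha).1 h1
  · exact (rowsum_ne_of_inv8 a hL.1 ha).2 h1

end Summit.Ventures.DiscreteObjects.Hadamard
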